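import Mathlib
import HarnessLib
import Summits.Ventures.LatticeQCDFlow.Exactness.SUNJitteredHMCAtomless
import Summits.Ventures.LatticeQCDFlow.Exactness.UniformDoeblinCertificate
import Summits.Ventures.LatticeQCDFlow.Exactness.SUNJitteredHMCFiguresOfMerit

/-!
# The jittered engine HMC: ONE Doeblin certificate — hence ONE `τ_int` constant — for EVERY law of the trajectory length that puts mass at least `p₀` on a short interval `[τ₁, τ₂]`

HONEST FRAMING: exact (Metropolis-corrected) sampling algorithms for lattice gauge theory;
figures of merit are autocorrelation/cost numbers at stated couplings and volumes; no
continuum-physics claim.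

Venture `LatticeQCDFlow` (cell pub-lqcd), topic `Exactness`, FANOUT row 9 (eng-latcore, GEN-24; the engine's
`hmc.HMC.trajectory(τ, nstep, tau_jitter = j)`, any law `η` of the drawn length).  NEW WORK of the cell over GEN-24's
`SUNJitteredHMCAtomless.lean` (`wilsonJitterHMCL_box_minorised`: `(η[τ₁, τ₂]·κ) • Haar^{⊗}|box ≤ K_η(U, ·)`),
`UniformDoeblinCertificate.lean` (a family sharing a box minorant shares ONE certificate and ONE geometric rate),
`SUNJitteredHMCMeasurableLabels.lean` (`wilsonJitterHMCL`, `wilsonJitterHMCL_invariant`), GEN-23's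
`SUNJitteredHMCFiguresOfMerit.lean` (`doeblinConst_nonneg`) and row 13's `NCMCGeneralSpaceDoeblinPower.lean`.  Nothing is
cited as a fact; no number is claimed.

WHY.  `SUNJitteredHMCAtomless.lean` certifies each jitter law `η` separately (constant carrying `η[τ₁, τ₂]`).  Here the
family of ALL laws with `η[τ₁, τ₂] ≥ p₀` — e.g. the code's `uniformJitterLaw τ j` for `(τ, j)` in any compact set with
`τ(1 − j) < τ₁` — gets ONE `(m, ε')`, ONE geometric rate and ONE `τ_int` constant `B`.

## Content (`K_η = wilsonJitterHMCL N d L β nstep η`, `π = wilsonMeasure (β/N)`, `τ₀ > 0` on `N, d, L, β` only)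

* **`wilsonJitterHMCL_exactStep_certificate_uniform`** — for every `nstep ≥ 1`, `0 < τ₁ ≤ τ₂ ≤ τ₀`, `p₀ ≠ 0` and EVERY
  Wilson-invariant Markov `P`: ONE `m > 0` and ONE `0 < ε' ≤ 1` with `ε' • π ≤ (P ∘ₖ K_η)^m(U, ·)` for EVERY probability
  law `η` on `ℝ` with `p₀ ≤ η[τ₁, τ₂]` and every `U`.
* **`wilsonJitterHMCL_exactStep_uniformlyErgodic_uniform`** — ONE `mm` and ONE `δ ∈ (0, 1]`:
  `|μ₀ (P ∘ₖ K_η)ᵗ(A) − π(A)| ≤ (1 − δ)^{⌊t/(mm+1)⌋}` for every such `η`, every start; uniqueness.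
* **`wilsonJitterHMCL_exactStep_tauInt_setACF_le_uniform`** — ONE `B ≥ 0`: `τ_int(1_A) ≤ 1/2 + B/(1 − π(A))` for every
  such `η` and every event `A` with `0 < π(A) < 1`.

NOT CLAIMED: any value of the constants; laws with `η[τ₁, τ₂] < p₀`; OMF words; floating point.
-/

noncomputable section

namespace Summit.Ventures.LatticeQCDFlow.Exactness

open MeasureTheory ProbabilityTheory ProbabilityTheory.Kernel Set Metric Function Filter Topology
open Literature.MathematicalPhysics.QuantumFieldTheory
open Literature.MathematicalPhysics.QuantumLattice (fundamentalRep continuous_fundamentalRep connectedSpace_specialUnitaryGroup)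
open scoped ENNReal Matrix Matrix.Norms.Operator NNReal

set_option backward.isDefEq.respectTransparency false

section Uniform

variable {N d L : ℕ} [NeZero N] [NeZero L] (β : ℝ)

/-- **ONE DOEBLIN CERTIFICATE FOR EVERY JITTER LAW CHARGING `[τ₁, τ₂]` WITH MASS AT LEAST `p₀`, FOLLOWED BY ANY EXACT
STEP.**  There is `τ₀ > 0` (on `N, d, L, β` only) such that for every `nstep ≥ 1`, `0 < τ₁ ≤ τ₂ ≤ τ₀`, `p₀ ≠ 0` and
EVERY Markov `P` leaving `wilsonMeasure (β/N)` invariant there are ONE `m > 0` and ONE `0 < ε' ≤ 1` with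
`ε' • wilsonMeasure (β/N) ≤ (P ∘ₖ K_η)^m(U, ·)` for EVERY probability law `η` with `p₀ ≤ η[τ₁, τ₂]` and EVERY `U`. -/
theorem wilsonJitterHMCL_exactStep_certificate_uniform :
    ∃ τ₀ : ℝ, 0 < τ₀ ∧ ∀ (nstep : ℕ) (τ₁ τ₂ : ℝ) (p₀ : ℝ≥0∞), 1 ≤ nstep → 0 < τ₁ → τ₁ ≤ τ₂ → τ₂ ≤ τ₀ → p₀ ≠ 0 →
      ∀ (P : Kernel (GaugeConfig d L (Matrix.specialUnitaryGroup (Fin N) ℂ))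
          (GaugeConfig d L (Matrix.specialUnitaryGroup (Fin N) ℂ))) [IsMarkovKernel P],
        Invariant P (wilsonMeasure (d := d) (L := L) (fundamentalRep (Fin N)) (β / N)) →
      ∃ m : ℕ, ∃ ε' : ℝ≥0∞, 0 < m ∧ 0 < ε' ∧ ε' ≤ 1 ∧
        ∀ (η : Measure ℝ) [IsProbabilityMeasure η], p₀ ≤ η (Icc τ₁ τ₂) →
        ∀ U : GaugeConfig d L (Matrix.specialUnitaryGroup (Fin N) ℂ),
          ε' • wilsonMeasure (d := d) (L := L) (fundamentalRep (Fin N)) (β / N) ≤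
            nHit (P ∘ₖ wilsonJitterHMCL N d L β nstep η) m U := by
  haveI : ConnectedSpace (Matrix.specialUnitaryGroup (Fin N) ℂ) := connectedSpace_specialUnitaryGroup
  obtain ⟨s, hs⟩ := exists_bound_smul_wilsonAction_sun N (d := d) (L := L) _ (continuous_fundamentalRep (Fin N)) (β / N)
  obtain ⟨τ₀, hτ₀, hbox⟩ := wilsonJitterHMCL_box_minorised (N := N) (d := d) (L := L) β
  refine ⟨τ₀, hτ₀, fun nstep τ₁ τ₂ p₀ hn hτ₁ h12 hτ₂ hp₀ P _ hP => ?_⟩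
  obtain ⟨V, hVo, hV1, κ, hκ, hK⟩ := hbox nstep τ₁ τ₂ hn hτ₁ h12 hτ₂
  obtain ⟨hlo, hhi⟩ := gibbsWeight_pinched (L := Edge d L) (n := Fin N) hs
  have heq := gibbsProbability_smul_wilsonAction_eq N (d := d) (L := L) (fundamentalRep (Fin N)) (β / N)
  rw [← heq] at hP
  -- the family: all probability laws with `p₀ ≤ η[τ₁, τ₂]`, common box minorant `(p₀ κ) • Haar^{⊗}|box`
  obtain ⟨mm, a, ha, hmin⟩ := exactStep_nHit_minorised_uniform_of_box_minorised (ι := Edge d L) (Real.exp_pos (-s)) hlo hhi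
    (T := {η : {η : Measure ℝ // IsProbabilityMeasure η} | p₀ ≤ η.1 (Icc τ₁ τ₂)})
    (K := fun η => wilsonJitterHMCL N d L β nstep η.1) hVo hV1 (mul_ne_zero hp₀ hκ)
    (fun η hη U => by
      haveI := η.2
      calc (p₀ * κ) • (Measure.pi fun _ : Edge d L => haarProbability (Matrix.specialUnitaryGroup (Fin N) ℂ)).restrict
              {W | ∀ j, W j * (U j)⁻¹ ∈ V}
          ≤ (η.1 (Icc τ₁ τ₂) * κ) • (Measure.pi fun _ : Edge d L =>
              haarProbability (Matrix.specialUnitaryGroup (Fin N) ℂ)).restrict {W | ∀ j, W j * (U j)⁻¹ ∈ V} := by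
            refine Measure.le_iff'.2 fun A => ?_
            simp only [Measure.smul_apply, smul_eq_mul]
            exact mul_le_mul' (mul_le_mul' hη le_rfl) le_rfl
        _ ≤ _ := hK η.1 U)
    P hP
  rw [heq] at hmin
  refine ⟨mm + 1, min a 1, Nat.succ_pos mm, lt_min (pos_iff_ne_zero.2 ha) one_pos, min_le_right _ _,
    fun η hη hp U => ?_⟩
  calc min a 1 • wilsonMeasure (d := d) (L := L) (fundamentalRep (Fin N)) (β / N)
      ≤ a • wilsonMeasure (d := d) (L := L) (fundamentalRep (Fin N)) (β / N) := by
        refine Measure.le_iff'.2 fun A => ?_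
        simp only [Measure.smul_apply, smul_eq_mul]
        exact mul_le_mul' (min_le_left _ _) le_rfl
    _ ≤ _ := hmin ⟨η, hη⟩ hp U

/-- **ONE GEOMETRIC RATE FOR EVERY JITTER LAW CHARGING `[τ₁, τ₂]` WITH MASS AT LEAST `p₀`** (+ ANY exact step):
ONE `mm` and ONE `δ ∈ (0, 1]` with `|μ₀ (P ∘ₖ K_η)ᵗ(A) − π(A)| ≤ (1 − δ)^{⌊t/(mm+1)⌋}` for every such `η`, every initial law,
every `t`, every `A`; and `π` is the unique invariant probability law of each `P ∘ₖ K_η`. -/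
theorem wilsonJitterHMCL_exactStep_uniformlyErgodic_uniform :
    ∃ τ₀ : ℝ, 0 < τ₀ ∧ ∀ (nstep : ℕ) (τ₁ τ₂ : ℝ) (p₀ : ℝ≥0∞), 1 ≤ nstep → 0 < τ₁ → τ₁ ≤ τ₂ → τ₂ ≤ τ₀ → p₀ ≠ 0 →
      ∀ (P : Kernel (GaugeConfig d L (Matrix.specialUnitaryGroup (Fin N) ℂ))
          (GaugeConfig d L (Matrix.specialUnitaryGroup (Fin N) ℂ))) [IsMarkovKernel P],
        Invariant P (wilsonMeasure (d := d) (L := L) (fundamentalRep (Fin N)) (β / N)) →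
      ∃ mm : ℕ, ∃ δ : ℝ, 0 < δ ∧ δ ≤ 1 ∧
        ∀ (η : Measure ℝ) [IsProbabilityMeasure η], p₀ ≤ η (Icc τ₁ τ₂) →
        (∀ (μ₀ : Measure (GaugeConfig d L (Matrix.specialUnitaryGroup (Fin N) ℂ))) [IsProbabilityMeasure μ₀]
          (t : ℕ) (A : Set (GaugeConfig d L (Matrix.specialUnitaryGroup (Fin N) ℂ))),
          |((fun m : Measure (GaugeConfig d L (Matrix.specialUnitaryGroup (Fin N) ℂ)) =>
                m.bind (P ∘ₖ wilsonJitterHMCL N d L β nstep η))^[t] μ₀).real A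
              - (wilsonMeasure (d := d) (L := L) (fundamentalRep (Fin N)) (β / N)).real A| ≤ (1 - δ) ^ (t / (mm + 1))) ∧
        ∀ (π' : Measure (GaugeConfig d L (Matrix.specialUnitaryGroup (Fin N) ℂ))) [IsProbabilityMeasure π'],
          Invariant (P ∘ₖ wilsonJitterHMCL N d L β nstep η) π' →
          π' = wilsonMeasure (d := d) (L := L) (fundamentalRep (Fin N)) (β / N) := by
  obtain ⟨τ₀, hτ₀, h⟩ := wilsonJitterHMCL_exactStep_certificate_uniform (N := N) (d := d) (L := L) β
  refine ⟨τ₀, hτ₀, fun nstep τ₁ τ₂ p₀ hn hτ₁ h12 hτ₂ hp₀ P _ hP => ?_⟩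
  obtain ⟨m, ε', hm, hε0, hε1, hmin⟩ := h nstep τ₁ τ₂ p₀ hn hτ₁ h12 hτ₂ hp₀ P hP
  obtain ⟨mm, rfl⟩ : ∃ mm, m = mm + 1 := ⟨m - 1, (Nat.succ_pred_eq_of_pos hm).symm⟩
  have hεtop : ε' ≠ ⊤ := ne_top_of_le_ne_top ENNReal.one_ne_top hε1
  refine ⟨mm, ε'.toReal, ENNReal.toReal_pos hε0.ne' hεtop,
    ENNReal.toReal_le_of_le_ofReal zero_le_one (by rwa [ENNReal.ofReal_one]), fun η _ hη => ⟨fun μ₀ _ t A => ?_, fun π' _ hπ' => ?_⟩⟩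
  · exact uniformlyErgodic_of_nHit_minorised (hmin η hη) (hP.comp (wilsonJitterHMCL_invariant (N := N) (d := d) (L := L) β nstep η)) μ₀ t A
  · exact invariant_unique_of_minorised (κ := nHit (P ∘ₖ wilsonJitterHMCL N d L β nstep η) (mm + 1)) (hmin η hη)
      hε0 (invariant_nHit (hP.comp (wilsonJitterHMCL_invariant (N := N) (d := d) (L := L) β nstep η)) _) (invariant_nHit hπ' _)

/-- **ONE `τ_int` CONSTANT FOR EVERY JITTER LAW CHARGING `[τ₁, τ₂]` WITH MASS AT LEAST `p₀` AND EVERY EVENT** (+ ANY exact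
step): ONE `B ≥ 0` with `τ_int(1_A) ≤ 1/2 + B/(1 − π(A))` for every such `η` and every measurable `A` with `0 < π(A) < 1`
— e.g. for the code's `uniformJitterLaw τ j` simultaneously over every compact set of `(τ, j)` with `τ(1 − j) < τ₁`. -/
theorem wilsonJitterHMCL_exactStep_tauInt_setACF_le_uniform :
    ∃ τ₀ : ℝ, 0 < τ₀ ∧ ∀ (nstep : ℕ) (τ₁ τ₂ : ℝ) (p₀ : ℝ≥0∞), 1 ≤ nstep → 0 < τ₁ → τ₁ ≤ τ₂ → τ₂ ≤ τ₀ → p₀ ≠ 0 →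
      ∀ (P : Kernel (GaugeConfig d L (Matrix.specialUnitaryGroup (Fin N) ℂ))
          (GaugeConfig d L (Matrix.specialUnitaryGroup (Fin N) ℂ))) [IsMarkovKernel P],
        Invariant P (wilsonMeasure (d := d) (L := L) (fundamentalRep (Fin N)) (β / N)) →
      ∃ B : ℝ, 0 ≤ B ∧ ∀ (η : Measure ℝ) [IsProbabilityMeasure η], p₀ ≤ η (Icc τ₁ τ₂) →
        ∀ A : Set (GaugeConfig d L (Matrix.specialUnitaryGroup (Fin N) ℂ)), MeasurableSet A →
        0 < (wilsonMeasure (d := d) (L := L) (fundamentalRep (Fin N)) (β / N)).real A →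
        (wilsonMeasure (d := d) (L := L) (fundamentalRep (Fin N)) (β / N)).real A < 1 →
        Scoring.tauInt (setACF (P ∘ₖ wilsonJitterHMCL N d L β nstep η)
            (wilsonMeasure (d := d) (L := L) (fundamentalRep (Fin N)) (β / N)) A) ≤
          1 / 2 + B / (1 - (wilsonMeasure (d := d) (L := L) (fundamentalRep (Fin N)) (β / N)).real A) := by
  obtain ⟨τ₀, hτ₀, h⟩ := wilsonJitterHMCL_exactStep_certificate_uniform (N := N) (d := d) (L := L) β
  refine ⟨τ₀, hτ₀, fun nstep τ₁ τ₂ p₀ hn hτ₁ h12 hτ₂ hp₀ P _ hP => ?_⟩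
  obtain ⟨m, ε', hm, hε0, hε1, hmin⟩ := h nstep τ₁ τ₂ p₀ hn hτ₁ h12 hτ₂ hp₀ P hP
  refine ⟨(m : ℝ) / ε'.toReal - 1, doeblinConst_nonneg hm hε0 hε1, fun η _ hη A hA h0 h1 => ?_⟩
  exact GeneralNCMC.tauInt_setACF_le_of_nHit (GeneralNCMC.minorised_setwise (hmin η hη)) hε0 hε1 hm
    (hP.comp (wilsonJitterHMCL_invariant (N := N) (d := d) (L := L) β nstep η)) hA h0 h1

end Uniform

end Summit.Ventures.LatticeQCDFlow.Exactness
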